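import Summits.BirchSwinnertonDyer.BirchSwinnertonDyer.Theorems.GenusKolyvaginAtTwoK1PosSuHalvesSwappedLedger
import HarnessLib

/-!
# Route `GenusKolyvaginAtTwo`, cruxes K₁⁺ `K1Pos` (stmt-BirchSwinnertonDyer-31468) / K₁⁻ `K1Neg` (31525), LINES 31/30 «su_halves»:
# THE SWAPPED LEDGER AT POSITIVE DEPTH, and its LOSSLESSNESS under the BSD pair

Seat `bsd-line-gk2-p3` g32 (PROVER seat 3/3, cell `bsd-f1-sign2`), `--supports stmt-BirchSwinnertonDyer-31525` (helper; closes nothing); sequel of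
`…K1PosSuHalvesSwappedLedger` (p781983) and `…K1NegSuHalvesStarFrameObstruction` (p781564).  THEOREMS ONLY (no definition, no named fact, no
`sorry`); standard axioms.  **BSD is NOT proved by this file; K1Pos / K1Neg are NOT proved; no item is closed.**  CONDITIONAL (D-0014) on the
route's four STATEMENT-ONLY published facts (Gross–Zagier 24148, GZK 19921, modularity 19273, Milne any-model 24149), displayed as hypotheses.

* `swappedLedger_le_of_index_le` — B2 AT DEPTH: on the swapped frame (rank-`1` `E` with `#Sel₂ = 2` carrying the Heegner datum, ANY `c ≠ 0`, ANY
  globally minimal twin `Wd` with `#Ш_an(Wd) = qd`), `ord₂ [E(K):ℤy_K] ≤ ord₂ c + ord₂ C(E)` ⟹ `ord₂ #Ш_an(E) + ord₂ qd ≤ 0`.  On the K₁⁻ twin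
  (`ord₂ C = 1`) this is the ledger of the DEPTH-ONE witness «`2 ∣ y_(K')`, `4 ∤ y_(K')`» — the shape a repaired rank-one half of LINE 30 must use,
  the depth-zero (★)-frame being refuted modulo the leaf (p781564).
* `two_mul_index_eq_of_bsdp` — LOSSLESSNESS: `BSD₂(E) ∧ BSD₂(Wd)` force `2·ord₂ [E(K):ℤy_K] = ord₂ #Ш(E_K) + 2 ord₂ c + 2 ord₂ C(E)`; so the BSD
  pair forces `ord₂ c + ord₂ C(E) ≤ ord₂ [E(K):ℤy_K]` (Gross–Zagier's `c·∏c_q ∣ [E(K):ℤy_K]` at `p = 2`) with equality iff `Ш(E_K)[2^∞] = 0`.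
  Generalises g28's `OneBit.twoDivExponent_eq_padicValNat_tamagawa_of_bsdp` (no hypothesis on the twin beyond global minimality; either sign).

References: [GrossZagier1986] V.§2 (2.2)–(2.3); [Milne1972ArithmeticAV] §1 Thm. 1; [Kramer1981] proof of Thm. 2; [Miller2011LMS] Def. 1.1.
-/

set_option autoImplicit false
set_option linter.dupNamespace false -- `Summit.<P>.<Sub>` repeats `BirchSwinnertonDyer` (D-0017)

noncomputable section

open scoped Classical

open WeierstrassCurve NumberField Literature.NumberTheory.EllipticCurves Literature.NumberTheory.EllipticCurves.ModularForms
  Literature.NumberTheory.EllipticCurves.Rank1Residual Literature.NumberTheory.EllipticCurves.Rank1Residual.Typed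
  Summit.BirchSwinnertonDyer.Rank1Residual Summit.BirchSwinnertonDyer.Rank1Residual.AdditivePotMult
  Summit.BirchSwinnertonDyer.BirchSwinnertonDyer.Theorems.CMExactDescent Summit.BirchSwinnertonDyer.BirchSwinnertonDyer.Theorems.GenusExact.TwinSwap

namespace Summit.BirchSwinnertonDyer.BirchSwinnertonDyer.Theorems.GenusExact.SuHalves.SwappedLedger

/-! ## §3 The ledger at positive depth and its losslessness -/

/-- **B2 AT DEPTH: if `ord₂ I ≤ ord₂ c + ord₂ C(E)` then `ord₂ #Ш_an(E) + ord₂ #Ш_an(Wd) ≤ 0`.**  Same frame as `swappedLedger` (rank-`1` `E` with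
`#Sel₂ = 2` carrying the Heegner datum, `K` odd-`d_K ≠ −3` Heegner, ANY datum with `c ≠ 0`, `P₀ = y_K` of infinite order, ANY globally minimal twin with
`#Ш_an(Wd) = qd`), plus the DEPTH BOUND `ord₂ [E(K):ℤP₀] ≤ ord₂ c + ord₂ C(E)`: then `ord₂ #Ш_an(E) + ord₂ qd ≤ 0`.  At depth `0` (`c` odd, `C(E)` odd,
`P₀ ∉ 2E(K)`) this is `swappedLedger_tfree`; on the K₁⁻ twin (`ord₂ C = 1`, `c` odd) it is the ledger of the DEPTH-ONE witness «`2 ∣ y_(K')`, `4 ∤ y_(K')`»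
— the shape a repaired rank-one half of LINE 30 must use (the depth-zero (★)-frame being refuted modulo the leaf, `…StarFrameObstruction`).
CONDITIONAL on the four named facts; nothing about BSD is proved. [cite: GrossZagier1986, V.§2 (2.2)] [cite: Milne1972ArithmeticAV, §1 Thm. 1]
[cite: Kramer1981, proof of Thm. 2] -/
theorem swappedLedger_le_of_index_le
    (W : WeierstrassCurve ℚ) [W.IsElliptic] [W.IsGloballyMinimal] [NeZero (W.conductorNorm ℤ)]
    (K : Type) [Field K] [NumberField K]
    (hGZ : gross_zagier (W.conductorNorm ℤ) W K) (hGZK : rank_eq_analyticRank_of_analyticRank_le_one)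
    (hmod : hasEntireLFunction_rat) (hMilneC : Milne1972.bsdQuotient_baseChange_quadratic_anyModel)
    (hr : W.analyticRank = 1) (hSel : Nat.card (W.selmerGroup 2) = 2)
    (hK : IsImaginaryQuadratic K) (hodd : Odd (NumberField.discr K)) (h3 : NumberField.discr K ≠ -3)
    (hH : SatisfiesHeegnerHypothesis (W.conductorNorm ℤ) K)
    (Dt : ModularParametrizationData W (W.conductorNorm ℤ)) (hc0 : Dt.c ≠ 0) (β : ℤ) (ι : K →+* ℂ)
    (d₁ : KolyvaginHeegnerData Dt β ι 1) (P₀ : (W.baseChange K).toAffine.Point)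
    (hP₀K : WeierstrassCurve.Affine.Point.map (W' := W) (algebraMap K (ringClassField K ι 1)).toRatAlgHom P₀ = d₁.derivedPoint)
    (hPinf : ¬ IsOfFinAddOrder P₀)
    (hI : (padicValNat 2 (AddSubgroup.zmultiples P₀).index : ℤ) ≤ padicValInt 2 Dt.c + padicValNat 2 W.tamagawaProduct)
    (Wd : WeierstrassCurve ℚ) [Wd.IsElliptic] [Wd.IsGloballyMinimal]
    (hWd : ∃ C : VariableChange ℚ, C • W.quadraticTwist (NumberField.discr K : ℚ) = Wd)
    (qd : ℚ) (hqd : shaAn Wd = (qd : ℂ)) :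
    ∃ qW : ℚ, shaAn W = (qW : ℂ) ∧ padicValRat 2 qW + padicValRat 2 qd ≤ 0 := by
  obtain ⟨-, hfinD, hShaK, hrkK, hiv, -, hShaW0, qW, hqW, -, -, hledger⟩ := swappedLedger W K hGZ hGZK hmod hMilneC hr hSel hK hodd h3 hH Dt
    hc0 β ι d₁ P₀ hP₀K hPinf Wd hWd qd hqd
  have hle := padicValNat_shaOrder_twist_le W K hK.1 Wd hWd hrkK hiv hfinD hShaK
  have hle' : (padicValNat 2 Wd.shaOrder : ℤ) ≤ (padicValNat 2 (W.baseChange K).shaOrder : ℤ) := by exact_mod_cast hle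
  refine ⟨qW, hqW, ?_⟩
  rw [hShaW0] at hledger
  simp only [Nat.cast_zero, add_zero] at hledger
  linarith

/-- **LOSSLESSNESS OF THE SWAPPED FRAME: `BSD₂(E) ∧ BSD₂(Wd)` force `2·ord₂ [E(K):ℤy_K] = ord₂ #Ш(E_K) + 2 ord₂ c + 2 ord₂ C(E)`.**  Same frame; in
particular the BSD pair forces `ord₂ c + ord₂ C(E) ≤ ord₂ [E(K):ℤy_K]` (the Heegner point is divisible by `2^(ord₂ c + ord₂ C(E))` — Gross–Zagier's
prediction `c·∏c_q ∣ [E(K):ℤy_K]` at `p = 2`) with EQUALITY iff `Ш(E_K)[2^∞] = 0`.  Generalises g28's one-bit `OneBit.twoDivExponent_eq_padicValNat_tamagawa_of_bsdp`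
(there `#Sel₂(Wd) = 1` forces `Ш(E_K)[2^∞] = 0`): NO hypothesis on the twin beyond global minimality, either sign of `Δ`.  A census certificate:
CONDITIONAL on the two `BSD₂` and the four named facts; nothing about BSD is proved.
[cite: GrossZagier1986, V.§2 (2.2)–(2.3)] [cite: Milne1972ArithmeticAV, §1 Thm. 1] [cite: Miller2011LMS, Def. 1.1] -/
theorem two_mul_index_eq_of_bsdp
    (W : WeierstrassCurve ℚ) [W.IsElliptic] [W.IsGloballyMinimal] [NeZero (W.conductorNorm ℤ)]
    (K : Type) [Field K] [NumberField K]
    (hGZ : gross_zagier (W.conductorNorm ℤ) W K) (hGZK : rank_eq_analyticRank_of_analyticRank_le_one)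
    (hmod : hasEntireLFunction_rat) (hMilneC : Milne1972.bsdQuotient_baseChange_quadratic_anyModel)
    (hr : W.analyticRank = 1) (hSel : Nat.card (W.selmerGroup 2) = 2)
    (hK : IsImaginaryQuadratic K) (hodd : Odd (NumberField.discr K)) (h3 : NumberField.discr K ≠ -3)
    (hH : SatisfiesHeegnerHypothesis (W.conductorNorm ℤ) K)
    (Dt : ModularParametrizationData W (W.conductorNorm ℤ)) (hc0 : Dt.c ≠ 0) (β : ℤ) (ι : K →+* ℂ)
    (d₁ : KolyvaginHeegnerData Dt β ι 1) (P₀ : (W.baseChange K).toAffine.Point)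
    (hP₀K : WeierstrassCurve.Affine.Point.map (W' := W) (algebraMap K (ringClassField K ι 1)).toRatAlgHom P₀ = d₁.derivedPoint)
    (hPinf : ¬ IsOfFinAddOrder P₀)
    (Wd : WeierstrassCurve ℚ) [Wd.IsElliptic] [Wd.IsGloballyMinimal]
    (hWd : ∃ C : VariableChange ℚ, C • W.quadraticTwist (NumberField.discr K : ℚ) = Wd)
    (hBW : BSDp W 2) (hBd : BSDp Wd 2) :
    2 * (padicValNat 2 (AddSubgroup.zmultiples P₀).index : ℤ) =
      (padicValNat 2 (W.baseChange K).shaOrder : ℤ) + 2 * padicValInt 2 Dt.c + 2 * (padicValNat 2 W.tamagawaProduct : ℤ) := by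
  haveI : Fact (Nat.Prime 2) := ⟨Nat.prime_two⟩
  obtain ⟨-, -, qd, hqd, hvd⟩ := hBd
  obtain ⟨hfinW, hfinD, -, -, -, -, hShaW0, qW, hqW, -, -, hledger⟩ := swappedLedger W K hGZ hGZK hmod hMilneC hr hSel hK hodd h3 hH Dt
    hc0 β ι d₁ P₀ hP₀K hPinf Wd hWd qd hqd
  obtain ⟨-, -, qW', hqW', hvW⟩ := hBW
  have hqq : qW' = qW := Rat.cast_injective (α := ℂ) (hqW'.symm.trans hqW)
  haveI : Finite W.sha := hfinW
  haveI : Finite Wd.sha := hfinD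
  rw [hqq, ← X11b.Three.Koly.padicValNat_shaOrder_eq W 2, hShaW0] at hvW
  rw [← X11b.Three.Koly.padicValNat_shaOrder_eq Wd 2] at hvd
  rw [hvW, hvd, hShaW0] at hledger
  simp only [Nat.cast_zero, zero_add, add_zero] at hledger
  linarith

end Summit.BirchSwinnertonDyer.BirchSwinnertonDyer.Theorems.GenusExact.SuHalves.SwappedLedger

end
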